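import Summits.BirchSwinnertonDyer.BirchSwinnertonDyer.Theorems.EisensteinPrimesMazurMCOnCellBTwistbackTwoStepDefs
import Literature.NumberTheory.EllipticCurves.IsogenyQuadraticTwistProofs
import Literature.NumberTheory.EllipticCurves.IsogenyConductorModularityProofs
import Literature.NumberTheory.EllipticCurves.ComplexMultiplicationLFunctionIsogenyHoldsProofs
import Literature.NumberTheory.EllipticCurves.IsogenyDualProofs
import HarnessLib

/-!
# Crux 3 `MazurMCOnCellB` (stmt-BirchSwinnertonDyer-19033), line `twistback` v9 — ROAD (e): the certified two-step edge
# `TwoStepAt p` and its chains are EQUIVARIANT UNDER A `ℚ`-ISOGENY OF THE START CURVE (up to a `ℚ`-isogeny of the far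
# end), so the «reachable Ш-unit class» datum of stub 6⁗ needs NO auxiliary start member `W₁`

Width seat bsd-line-x2-p1-w6 (gen 4), cell `bsd-eis`, 2026-08-28; `--supports stmt-BirchSwinnertonDyer-19033 --as helper`;
sequel of the same lineage's `…TwistbackTwoStepDefs` (p667979: the edge `TwoStepAt`), `…TwistbackTwoStepChain` (p668570)
and `…TwistbackTwoStepIsogenousShaUnit` (p670779). HONEST FRAMING: conditional theorems only (the one named-fact
hypothesis is modularity in the form `nonempty_modularParametrizationData`, conjunct 5 of the route's `PublishedInputs`,
used only to move the conductor along a `ℚ`-isogeny); no `def`, no named fact introduced, no `sorry`; closes no registered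
stub; no summit statement, no Mazur main conjecture and no BSD is proved for any curve; 0 cells / labels / stubs / tiers
move. Whether every X2b class REACHES a Ш-unit class (idea-12's `UnitAnchorSupply`) is OPEN and not claimed.

WHY THIS FILE. The registered stub 6⁗ of twistback v9 (LEAD x2-p1 g14, 21:58:26Z; `Cruxes/MazurMCOnCellB/Lines/twistback.lean`,
sha256 c4adf2f8…) excludes the X2b pairs `(W, p)` carrying the datum
«`∃ W₁ W″ Wc` globally minimal, `W ∼ W₁`, `Relation.ReflTransGen (TwoStepAt p) W₁ W″`, `W″ ∼ Wc`, `#Ш_an(Wc)` a rational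
`p`-unit» — the start member `W₁` is there to make the excluded population visibly a union of `ℚ`-isogeny classes (x2-p1-w5
g3's first TARGET witness reads the unit on a twist of 70971a1 while the cell of record is stated at both members). This
file proves that the device is REDUNDANT: a certified two-step edge out of ANY member `W₁` of the isogeny class of `W` is
shadowed by a certified two-step edge out of `W` itself whose far end is `ℚ`-isogenous to the original far end
(`exists_twoStepAt_of_isIsogenous`, §1), and the same along finite chains (`exists_reflTransGen_twoStepAt_of_isIsogenous`,
§2); hence the v9 datum is EQUIVALENT to its `W₁`-free form «`∃ W″ Wc`, `Relation.ReflTransGen (TwoStepAt p) W W″`,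
`W″ ∼ Wc`, unit» (`exists_reachableClassShaUnit_iff`, §3), and either form is constant on the `ℚ`-isogeny class of `W`
(`exists_reachableShaUnitClass_iff_of_isIsogenous`). So a later reshape may drop the `W₁` binder with nothing lost (the two
negated hypotheses are interchangeable: `not_exists_reachableClassShaUnit_iff`), and a per-cell road-(e) certificate may be
typed at whichever Cremona member is convenient and read at every member through the kernel isogenies of x2-p1-w7 g3's
`…A10IsogenyCertificates01` (p671549).

THE ARGUMENT (§1; Cremona, *Algorithms* §3.9 «twisting commutes with isogenies»; Knapp Thm. 11.67 «isogenous curves have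
the same `L`-function»; Atkin–Lehner / modularity «isogenous curves have the same conductor»). Given `W ∼ W₁` and an edge
`TwoStepAt p W₁ W″` with data `(K, Wd, K″)`: `N_W = N_{W₁}` (`conductorNorm_eq_of_isIsogenous_of_modularity_of_isGloballyMinimal`),
so `K` is Heegner for `N_W`; `W^{(d_K)} ∼ W₁^{(d_K)}` (`IsIsogenous.quadraticTwist`), so `r_an(W^{(d_K)}) = r_an(W₁^{(d_K)}) = 1`
(`analyticRank_eq_of_isIsogenous'`); a globally minimal model `Wd′` of `W^{(d_K)}` (`hasGlobalMinimalModel_rat_holds`) is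
isogenous to `Wd`, so `N_{Wd′} = N_{Wd}` and `K″` is Heegner for `N_{Wd′}`; `Wd′^{(d_{K″})} ∼ Wd^{(d_{K″})}`, so
`L(Wd′^{(d_{K″})}, 1) = L(Wd^{(d_{K″})}, 1) ≠ 0` (`entireLFunction_eq_of_isIsogenous'`); and a globally minimal model `W₂` of
`Wd′^{(d_{K″})}` is the far end of an edge `TwoStepAt p W W₂` (`twoStepAt_intro`) with `W₂ ∼ Wd′^{(d_{K″})} ∼ Wd^{(d_{K″})} ∼ W″`.
§2 is head induction on `Relation.ReflTransGen`.

References: x2-p1-w6 g3 p667979 / p668570 / p670779; LEAD g14 v9 skeleton and `…OfNamedFactsV9` (p671228); x2-p1-w7 g3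
p671549; J. E. Cremona, *Algorithms for Modular Elliptic Curves* (1997) §3.9 p. 87 [CremonaAlgorithms1997]; A. W. Knapp,
*Elliptic Curves* (1992) Thm. 11.67 [Knapp1993]; A. O. L. Atkin, J. Lehner, Math. Ann. 185 (1970) Thm. 4 [AtkinLehner1970];
C. Breuil, B. Conrad, F. Diamond, R. Taylor, J. AMS 14 (2001) Thm. A [BCDTJAMS2001]; J. H. Silverman, *ATAEC* Ex. 4.40
[SilvermanATAEC1994].
-/

set_option autoImplicit false

-- `Summit.BirchSwinnertonDyer.BirchSwinnertonDyer.…`: the summit and its single sub-problem share a name.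
set_option linter.dupNamespace false

noncomputable section

open scoped Classical

open WeierstrassCurve NumberField
  Literature.NumberTheory.EllipticCurves
  Literature.NumberTheory.EllipticCurves.ModularForms
  Literature.NumberTheory.QuadraticFields
  Literature.NumberTheory.EllipticCurves.Rank1Residual
  Literature.NumberTheory.EllipticCurves.Rank1Residual.Typed
  Summit.BirchSwinnertonDyer.Rank1Residual
  Summit.BirchSwinnertonDyer.BirchSwinnertonDyer.Theorems.EisensteinPrimesMazurMCOnCellBTwistbackTwoStepDefs

namespace Summit.BirchSwinnertonDyer.BirchSwinnertonDyer.Theorems.EisensteinPrimesMazurMCOnCellBTwistbackTwoStepIsogenyInvariance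

/-! ## §1. One edge: a certified two-step out of an isogenous curve is shadowed by one out of `W` -/

/-- **`TwoStepAt p` is equivariant under a `ℚ`-isogeny of the start curve, up to a `ℚ`-isogeny of the far end.** If `W`
is a globally minimal elliptic curve, `W ∼ W₁` over `ℚ`, and `TwoStepAt p W₁ W″` (a certified two-step edge out of `W₁`
with fields `K`, `K″` and intermediate minimal model `Wd` of `W₁^{(d_K)}`), then there is a globally minimal `W₂` with
`TwoStepAt p W W₂` — the SAME fields `K`, `K″`, a minimal model of `W^{(d_K)}` in between — and `W₂ ∼ W″` over `ℚ`. Inputs: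
the conductor is an isogeny invariant granted modularity (`conductorNorm_eq_of_isIsogenous_of_modularity_of_isGloballyMinimal`,
Atkin–Lehner Thm. 4 + BCDT), twisting commutes with isogenies (`IsIsogenous.quadraticTwist`, Cremona §3.9), isogenous curves
have the same `L`-function and analytic rank (`entireLFunction_eq_of_isIsogenous'`, `analyticRank_eq_of_isIsogenous'`,
Knapp Thm. 11.67), global minimal models exist over `ℚ` (`hasGlobalMinimalModel_rat_holds`). Conditional on `hmodN` only.
[cite: CremonaAlgorithms1997, §3.9 (p. 87)] -/
theorem exists_twoStepAt_of_isIsogenous (hmodN : nonempty_modularParametrizationData)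
    {p : ℕ} {W W₁ W'' : WeierstrassCurve ℚ} [W.IsElliptic] [W.IsGloballyMinimal]
    (hiso : IsIsogenous W W₁) (h : TwoStepAt p W₁ W'') :
    ∃ (W₂ : WeierstrassCurve ℚ) (_ : W₂.IsElliptic) (_ : W₂.IsGloballyMinimal),
      TwoStepAt p W W₂ ∧ IsIsogenous W₂ W'' := by
  obtain ⟨_, _, _, _, K, _, _, hK, hHN, hHp, hoddK, hlt, hr1, Wd, _, _, ⟨C, hC⟩, K'', _, _, hK'', hodd'', hlt'',
    hHN'', hHp'', hL'', ⟨C'', hC''⟩⟩ := h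
  have hdK : ((NumberField.discr K : ℤ) : ℚ) ≠ 0 := by exact_mod_cast (by omega : NumberField.discr K ≠ 0)
  have hdK'' : ((NumberField.discr K'' : ℤ) : ℚ) ≠ 0 := by exact_mod_cast (by omega : NumberField.discr K'' ≠ 0)
  -- the conductor moves along `W ∼ W₁`
  have hN : W.conductorNorm ℤ = W₁.conductorNorm ℤ :=
    conductorNorm_eq_of_isIsogenous_of_modularity_of_isGloballyMinimal hmodN hiso
  -- the partner twists are isogenous, so the analytic rank is `1` on `W`'s side too
  haveI := W.isElliptic_quadraticTwist hdK
  haveI := W₁.isElliptic_quadraticTwist hdK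
  have hisoK : IsIsogenous (W.quadraticTwist (NumberField.discr K : ℚ))
      (W₁.quadraticTwist (NumberField.discr K : ℚ)) := hiso.quadraticTwist hdK
  have hr1' : (W.quadraticTwist (NumberField.discr K : ℚ)).analyticRank = 1 := by
    rw [analyticRank_eq_of_isIsogenous' hisoK]; exact hr1
  -- a globally minimal model `Wd'` of `W^{(d_K)}`, isogenous to `Wd`
  obtain ⟨Cm, hCm⟩ := hasGlobalMinimalModel_rat_holds (W.quadraticTwist (NumberField.discr K : ℚ))
  haveI := hCm
  have hWd' : ∃ C₀ : VariableChange ℚ,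
      C₀ • (Cm • W.quadraticTwist (NumberField.discr K : ℚ)) = W.quadraticTwist (NumberField.discr K : ℚ) :=
    ⟨Cm⁻¹, inv_smul_smul Cm _⟩
  have hisod : IsIsogenous (Cm • W.quadraticTwist (NumberField.discr K : ℚ)) Wd :=
    (isIsogenous_of_smul _ Cm).trans' (hisoK.trans' (isIsogenous_of_smul_eq' hC))
  have hNd : (Cm • W.quadraticTwist (NumberField.discr K : ℚ)).conductorNorm ℤ = Wd.conductorNorm ℤ :=
    conductorNorm_eq_of_isIsogenous_of_modularity_of_isGloballyMinimal hmodN hisod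
  -- the double twists are isogenous, so the non-vanishing reading transfers
  haveI := (Cm • W.quadraticTwist (NumberField.discr K : ℚ)).isElliptic_quadraticTwist hdK''
  haveI := Wd.isElliptic_quadraticTwist hdK''
  have hiso'' : IsIsogenous ((Cm • W.quadraticTwist (NumberField.discr K : ℚ)).quadraticTwist
      (NumberField.discr K'' : ℚ)) (Wd.quadraticTwist (NumberField.discr K'' : ℚ)) :=
    hisod.quadraticTwist hdK''
  have hL' : ((Cm • W.quadraticTwist (NumberField.discr K : ℚ)).quadraticTwist
      (NumberField.discr K'' : ℚ)).entireLFunction 1 ≠ 0 := by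
    rw [entireLFunction_eq_of_isIsogenous' hiso'']; exact hL''
  -- a globally minimal model `W₂` of the double twist on `W`'s side: the far end of the shadow edge
  obtain ⟨C₂, hC₂⟩ := hasGlobalMinimalModel_rat_holds
    ((Cm • W.quadraticTwist (NumberField.discr K : ℚ)).quadraticTwist (NumberField.discr K'' : ℚ))
  haveI := hC₂
  have hW₂ : ∃ C₀ : VariableChange ℚ,
      C₀ • (C₂ • (Cm • W.quadraticTwist (NumberField.discr K : ℚ)).quadraticTwist (NumberField.discr K'' : ℚ)) =
        (Cm • W.quadraticTwist (NumberField.discr K : ℚ)).quadraticTwist (NumberField.discr K'' : ℚ) :=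
    ⟨C₂⁻¹, inv_smul_smul C₂ _⟩
  refine ⟨C₂ • (Cm • W.quadraticTwist (NumberField.discr K : ℚ)).quadraticTwist (NumberField.discr K'' : ℚ),
    inferInstance, hC₂, ?_, ?_⟩
  · exact twoStepAt_intro p W K hK (by rw [hN]; exact hHN) hHp hoddK hlt hr1'
      (Cm • W.quadraticTwist (NumberField.discr K : ℚ)) hWd' K'' hK'' hodd'' hlt'' (by rw [hNd]; exact hHN'') hHp'' hL'
      _ hW₂
  · exact (isIsogenous_of_smul _ C₂).trans' (hiso''.trans' (isIsogenous_of_smul_eq' hC''))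

/-! ## §2. Chains: reachability along `TwoStepAt p` is equivariant under a `ℚ`-isogeny of the start curve -/

/-- **Chains of certified two-steps are equivariant under a `ℚ`-isogeny of the start curve, up to a `ℚ`-isogeny of the
far end**: if `W ∼ W₁` and `Relation.ReflTransGen (TwoStepAt p) W₁ W″`, then some globally minimal `W₂` has
`Relation.ReflTransGen (TwoStepAt p) W W₂` and `W₂ ∼ W″` (head induction on the chain, §1 at each edge; the empty chain
gives `W₂ = W`). Conditional on `hmodN` only. [folklore] -/
theorem exists_reflTransGen_twoStepAt_of_isIsogenous (hmodN : nonempty_modularParametrizationData)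
    {p : ℕ} {W W₁ W'' : WeierstrassCurve ℚ} [W.IsElliptic] [W.IsGloballyMinimal]
    (hiso : IsIsogenous W W₁) (h : Relation.ReflTransGen (TwoStepAt p) W₁ W'') :
    ∃ (W₂ : WeierstrassCurve ℚ) (_ : W₂.IsElliptic) (_ : W₂.IsGloballyMinimal),
      Relation.ReflTransGen (TwoStepAt p) W W₂ ∧ IsIsogenous W₂ W'' := by
  have key : ∀ {a : WeierstrassCurve ℚ}, Relation.ReflTransGen (TwoStepAt p) a W'' →
      ∀ (V : WeierstrassCurve ℚ) (_ : V.IsElliptic) (_ : V.IsGloballyMinimal), IsIsogenous V a →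
        ∃ (W₂ : WeierstrassCurve ℚ) (_ : W₂.IsElliptic) (_ : W₂.IsGloballyMinimal),
          Relation.ReflTransGen (TwoStepAt p) V W₂ ∧ IsIsogenous W₂ W'' := by
    intro a ha
    induction ha using Relation.ReflTransGen.head_induction_on with
    | refl =>
      intro V _ _ hV
      exact ⟨V, inferInstance, inferInstance, Relation.ReflTransGen.refl, hV⟩
    | head hab hbc ih =>
      intro V _ _ hV
      obtain ⟨V₂, _, _, hV₂, hiso₂⟩ := exists_twoStepAt_of_isIsogenous hmodN hV hab
      obtain ⟨W₂, _, _, hW₂, hisoW⟩ := ih V₂ inferInstance inferInstance hiso₂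
      exact ⟨W₂, inferInstance, inferInstance, Relation.ReflTransGen.head hV₂ hW₂, hisoW⟩
  exact key h W inferInstance inferInstance hiso

/-- **The same at distance `≥ 1`** (`Relation.TransGen`): a non-empty chain out of `W₁ ∼ W` is shadowed by a non-empty chain
out of `W` with isogenous far end. Conditional on `hmodN` only. [folklore] -/
theorem exists_transGen_twoStepAt_of_isIsogenous (hmodN : nonempty_modularParametrizationData)
    {p : ℕ} {W W₁ W'' : WeierstrassCurve ℚ} [W.IsElliptic] [W.IsGloballyMinimal]
    (hiso : IsIsogenous W W₁) (h : Relation.TransGen (TwoStepAt p) W₁ W'') :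
    ∃ (W₂ : WeierstrassCurve ℚ) (_ : W₂.IsElliptic) (_ : W₂.IsGloballyMinimal),
      Relation.TransGen (TwoStepAt p) W W₂ ∧ IsIsogenous W₂ W'' := by
  obtain ⟨b, hab, hbc⟩ := Relation.TransGen.head'_iff.mp h
  obtain ⟨V₂, _, _, hV₂, hiso₂⟩ := exists_twoStepAt_of_isIsogenous hmodN hiso hab
  obtain ⟨W₂, _, _, hW₂, hisoW⟩ := exists_reflTransGen_twoStepAt_of_isIsogenous hmodN hiso₂ hbc
  exact ⟨W₂, inferInstance, inferInstance, Relation.TransGen.head' hV₂ hW₂, hisoW⟩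

/-! ## §3. The v9 datum «a Ш-unit class is reachable from the isogeny class of `W`» needs no start member -/

/-- **The excluded datum of twistback v9's stub 6⁗ is a union of `ℚ`-isogeny classes** (fact-free, by transitivity of
`IsIsogenous`): if `W' ∼ W` and some `W₁ ∼ W` reaches by certified two-steps a curve whose isogeny class carries a
rational `p`-unit `#Ш_an`, then the same holds for `W'` (with the same `W₁`). Bookkeeping. [folklore] -/
theorem exists_reachableClassShaUnit_of_isIsogenous {p : ℕ} {W W' : WeierstrassCurve ℚ} (hWW' : IsIsogenous W' W)
    (h : ∃ (W₁ : WeierstrassCurve ℚ) (_ : W₁.IsElliptic) (_ : W₁.IsGloballyMinimal)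
        (W'' : WeierstrassCurve ℚ) (_ : W''.IsElliptic) (_ : W''.IsGloballyMinimal)
        (Wc : WeierstrassCurve ℚ) (_ : Wc.IsElliptic) (_ : Wc.IsGloballyMinimal),
        IsIsogenous W W₁ ∧ Relation.ReflTransGen (TwoStepAt p) W₁ W'' ∧ IsIsogenous W'' Wc ∧
        ∃ q : ℚ, shaAn Wc = (q : ℂ) ∧ padicValRat p q = 0) :
    ∃ (W₁ : WeierstrassCurve ℚ) (_ : W₁.IsElliptic) (_ : W₁.IsGloballyMinimal)
      (W'' : WeierstrassCurve ℚ) (_ : W''.IsElliptic) (_ : W''.IsGloballyMinimal)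
      (Wc : WeierstrassCurve ℚ) (_ : Wc.IsElliptic) (_ : Wc.IsGloballyMinimal),
      IsIsogenous W' W₁ ∧ Relation.ReflTransGen (TwoStepAt p) W₁ W'' ∧ IsIsogenous W'' Wc ∧
      ∃ q : ℚ, shaAn Wc = (q : ℂ) ∧ padicValRat p q = 0 := by
  obtain ⟨W₁, _, _, W'', _, _, Wc, _, _, h₁, hch, hc, hu⟩ := h
  exact ⟨W₁, inferInstance, inferInstance, W'', inferInstance, inferInstance, Wc, inferInstance, inferInstance,
    hWW'.trans' h₁, hch, hc, hu⟩

/-- **The start member `W₁` of the v9 datum is redundant** (granted modularity, for the conductor): at a globally minimal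
elliptic `W`, «`∃ W₁ ∼ W`, `∃ W″ Wc`, `Relation.ReflTransGen (TwoStepAt p) W₁ W″`, `W″ ∼ Wc`, `#Ш_an(Wc)` a rational
`p`-unit» holds iff «`∃ W″ Wc`, `Relation.ReflTransGen (TwoStepAt p) W W″`, `W″ ∼ Wc`, `#Ш_an(Wc)` a rational `p`-unit».
(`→`: §2 and transitivity at the far end; `←`: `W₁ := W`, `isIsogenous_self`.) The left side is VERBATIM the negated third
hypothesis of `stub_upperPartnerOffSubrowNoReachableClassShaUnit` (twistback v9). Conditional on `hmodN` only. [folklore] -/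
theorem exists_reachableClassShaUnit_iff (hmodN : nonempty_modularParametrizationData)
    {p : ℕ} (W : WeierstrassCurve ℚ) [W.IsElliptic] [W.IsGloballyMinimal] :
    (∃ (W₁ : WeierstrassCurve ℚ) (_ : W₁.IsElliptic) (_ : W₁.IsGloballyMinimal)
        (W'' : WeierstrassCurve ℚ) (_ : W''.IsElliptic) (_ : W''.IsGloballyMinimal)
        (Wc : WeierstrassCurve ℚ) (_ : Wc.IsElliptic) (_ : Wc.IsGloballyMinimal),
        IsIsogenous W W₁ ∧ Relation.ReflTransGen (TwoStepAt p) W₁ W'' ∧ IsIsogenous W'' Wc ∧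
        ∃ q : ℚ, shaAn Wc = (q : ℂ) ∧ padicValRat p q = 0) ↔
    (∃ (W'' : WeierstrassCurve ℚ) (_ : W''.IsElliptic) (_ : W''.IsGloballyMinimal)
        (Wc : WeierstrassCurve ℚ) (_ : Wc.IsElliptic) (_ : Wc.IsGloballyMinimal),
        Relation.ReflTransGen (TwoStepAt p) W W'' ∧ IsIsogenous W'' Wc ∧
        ∃ q : ℚ, shaAn Wc = (q : ℂ) ∧ padicValRat p q = 0) := by
  constructor
  · rintro ⟨W₁, _, _, W'', _, _, Wc, _, _, h₁, hch, hc, hu⟩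
    obtain ⟨W₂, _, _, hW₂, hiso₂⟩ := exists_reflTransGen_twoStepAt_of_isIsogenous hmodN h₁ hch
    exact ⟨W₂, inferInstance, inferInstance, Wc, inferInstance, inferInstance, hW₂, hiso₂.trans' hc, hu⟩
  · rintro ⟨W'', _, _, Wc, _, _, hch, hc, hu⟩
    exact ⟨W, inferInstance, inferInstance, W'', inferInstance, inferInstance, Wc, inferInstance, inferInstance,
      isIsogenous_self W, hch, hc, hu⟩

/-- **The two candidate third hypotheses of the stub are interchangeable**: the negation of the v9 datum (with `W₁`) is
equivalent to the negation of its `W₁`-free form — so a reshape 6⁗ ↦ «no Ш-unit class reachable FROM `W`» changes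
nothing in content (each stub statement implies the other over the v9 cone, which contains `hmodN` inside
`PublishedInputs`). Conditional on `hmodN` only. [folklore] -/
theorem not_exists_reachableClassShaUnit_iff (hmodN : nonempty_modularParametrizationData)
    {p : ℕ} (W : WeierstrassCurve ℚ) [W.IsElliptic] [W.IsGloballyMinimal] :
    (¬ ∃ (W₁ : WeierstrassCurve ℚ) (_ : W₁.IsElliptic) (_ : W₁.IsGloballyMinimal)
        (W'' : WeierstrassCurve ℚ) (_ : W''.IsElliptic) (_ : W''.IsGloballyMinimal)
        (Wc : WeierstrassCurve ℚ) (_ : Wc.IsElliptic) (_ : Wc.IsGloballyMinimal),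
        IsIsogenous W W₁ ∧ Relation.ReflTransGen (TwoStepAt p) W₁ W'' ∧ IsIsogenous W'' Wc ∧
        ∃ q : ℚ, shaAn Wc = (q : ℂ) ∧ padicValRat p q = 0) ↔
    (¬ ∃ (W'' : WeierstrassCurve ℚ) (_ : W''.IsElliptic) (_ : W''.IsGloballyMinimal)
        (Wc : WeierstrassCurve ℚ) (_ : Wc.IsElliptic) (_ : Wc.IsGloballyMinimal),
        Relation.ReflTransGen (TwoStepAt p) W W'' ∧ IsIsogenous W'' Wc ∧
        ∃ q : ℚ, shaAn Wc = (q : ℂ) ∧ padicValRat p q = 0) :=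
  not_congr (exists_reachableClassShaUnit_iff hmodN W)

/-- **Reachability of a Ш-unit class FROM `W` is constant on the `ℚ`-isogeny class of `W`** (the `W₁`-free form is
isogeny-invariant as well, granted modularity): for globally minimal elliptic `W ∼ W'`, a Ш-unit class is reachable by
certified two-steps from `W` iff one is reachable from `W'`. (§3's equivalence at `W` and at `W'`, and the fact-free
transport of the `W₁`-form.) Conditional on `hmodN` only. [folklore] -/
theorem exists_reachableShaUnitClass_iff_of_isIsogenous (hmodN : nonempty_modularParametrizationData)
    {p : ℕ} {W W' : WeierstrassCurve ℚ} [W.IsElliptic] [W.IsGloballyMinimal] [W'.IsElliptic] [W'.IsGloballyMinimal]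
    (hiso : IsIsogenous W W') :
    (∃ (W'' : WeierstrassCurve ℚ) (_ : W''.IsElliptic) (_ : W''.IsGloballyMinimal)
        (Wc : WeierstrassCurve ℚ) (_ : Wc.IsElliptic) (_ : Wc.IsGloballyMinimal),
        Relation.ReflTransGen (TwoStepAt p) W W'' ∧ IsIsogenous W'' Wc ∧
        ∃ q : ℚ, shaAn Wc = (q : ℂ) ∧ padicValRat p q = 0) ↔
    (∃ (W'' : WeierstrassCurve ℚ) (_ : W''.IsElliptic) (_ : W''.IsGloballyMinimal)
        (Wc : WeierstrassCurve ℚ) (_ : Wc.IsElliptic) (_ : Wc.IsGloballyMinimal),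
        Relation.ReflTransGen (TwoStepAt p) W' W'' ∧ IsIsogenous W'' Wc ∧
        ∃ q : ℚ, shaAn Wc = (q : ℂ) ∧ padicValRat p q = 0) := by
  rw [← exists_reachableClassShaUnit_iff hmodN W, ← exists_reachableClassShaUnit_iff hmodN W']
  exact ⟨exists_reachableClassShaUnit_of_isIsogenous hiso.symm_of_charZero,
    exists_reachableClassShaUnit_of_isIsogenous hiso⟩

end Summit.BirchSwinnertonDyer.BirchSwinnertonDyer.Theorems.EisensteinPrimesMazurMCOnCellBTwistbackTwoStepIsogenyInvariance

end
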